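import Summits.HodgeConjecture.CorCM.IrreducibleOddWeightsIsotypicFrobeniusCMFields
import HarnessLib

/-!
# Isotypic cells, Frobenius VI: BOUNDS AND MONOTONICITY OF THE MULTIPLICITIES — `m_c ≤ dim A_c/δ_c`, and a slot
# with a smaller stabiliser has larger multiplicities (`Stab(x₁) ≤ Stab(x₂) ⟹ m_{2,c} ≤ m_{1,c}`)

COR-CM (cell `pub-hodgecm2`, binder seat `b16` gen 77, count-neutral claim FROBENIUS RECIPROCITY IN THE REFERENCE
CURRENCY — MULTIPLICITIES FROM FIXED POINTS, file R6 — consequences of file R3's count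
`m_c·δ_c = dim A_c^{Stab(x₀)}`; theorems only, no definition, no named fact, no `sorry`).  NEW as stated, hence
under `Summits/`.  HONEST FRAMING: finite-dimensional linear algebra — the fixed subspace of a BIGGER subgroup is
SMALLER, so Frobenius reciprocity turns inclusions of stabilisers into inequalities of multiplicities: every
reference irreducible occurs in a transitive permutation module at most `dim A_c/δ_c` times (its multiplicity in
the regular representation), and for two transitive slots `Y₁ ∋ x₁`, `Y₂ ∋ x₂` decomposed over the same
references with `Stab(x₁) ≤ Stab(x₂)` (a `G`-map `Y₁ → Y₂`, `x₁ ↦ x₂`; for fields: `K₂ ⊆ K₁` with compatible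
embeddings) **`m_{2,c} ≤ m_{1,c}` for every class** — `ℚ^{Hom(K₂, ℂ)}` is, class by class, dominated by
`ℚ^{Hom(K₁, ℂ)}`.  Nothing about Hodge classes is asserted; `HC_CM` is neither used nor asserted.

* §1 ONE SLOT: `card_mul_finrank_map_applyₗ_le_finrank` (`|J_{c₀}|·δ ≤ dim A_{c₀}`), `card_le_finrank_div`.
* §2 TWO SLOTS OF A FAMILY (M-series data, references shared): **`card_le_card_of_stabilizer_le`** —
  `Stab(x₁) ≤ Stab(x₂) ⟹ |J_{i₂,c}| ≤ |J_{i₁,c}|`; `card_eq_card_of_stabilizer_eq`.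
* §3 NO INPUT BUT THE SLOTS: `exists_isotypic_card_le` (both bounds for the decomposition of gen 76 E3).
* §4 NUMBER FIELDS: **`exists_isotypic_card_le_card_of_ringHom`** — for `e : K_{i₂} → K_{i₁}` every
  `Aut(ℂ)`-irreducible occurs in `ℚ^{Hom(K_{i₂}, ℂ)}` at most as often as in `ℚ^{Hom(K_{i₁}, ℂ)}`, and at most
  `dim A_c/δ_c` times.

## References

* [LangeRodriguez2022] H. Lange, R. E. Rodríguez, *Decomposition of Jacobians by Prym Varieties*, LNM 2310 (2022),
  §2.8 Lemma 2.8.1 and (2.21)–(2.23).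
* [Serre1977] J.-P. Serre, *Linear Representations of Finite Groups*, GTM 42, §2.6, §7.2 Thm. 13, §12.1.
* [Gordon1999HodgeAVSurvey] B. B. Gordon, *A survey of the Hodge conjecture for abelian varieties*, §9.2 (proof).
-/

set_option autoImplicit false

noncomputable section

open scoped BigOperators Classical

universe u uC uJ v vC w

namespace Summit.HodgeConjecture.CorCM.IrrOdd

variable {G : Type w} [Group G]

/-! ### §1 One slot: `m_{c₀}·δ ≤ dim A_{c₀}` -/

section OneSlot

variable {Y₀ : Type v} [MulAction G Y₀] [Fintype Y₀] {C : Type uC} [Fintype C] {Yc : C → Type vC}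
  [∀ c, MulAction G (Yc c)] [∀ c, Fintype (Yc c)] {Ar : ∀ c, Submodule ℚ (Yc c → ℚ)}
  {JJ : C → Type uJ} [∀ c, Fintype (JJ c)]

/-- **`|J_{c₀}|·δ_{c₀} ≤ dim A_{c₀}`**: the multiplicity of a reference irreducible in the permutation module of a
transitive slot is at most its multiplicity `dim A/δ` in the regular representation (`A ⊓ F ≤ A`).
[cite: LangeRodriguez2022, §2.8 Lemma 2.8.1 and (2.21)–(2.23)] [cite: Serre1977, §12.1] -/
theorem card_mul_finrank_map_applyₗ_le_finrank {c₀ : C}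
    {𝒟 : Submodule ℚ ((Yc c₀ → ℚ) →ₗ[ℚ] (Yc c₀ → ℚ))}
    (h𝒟 : ∀ L : (Yc c₀ → ℚ) →ₗ[ℚ] (Yc c₀ → ℚ), L ∈ 𝒟 ↔ (∀ a ∈ Ar c₀, L a ∈ Ar c₀) ∧
      ∀ (k : G) (a : Yc c₀ → ℚ), a ∈ Ar c₀ → L (fun y => a (k • y)) = fun y => L a (k • y))
    (hRst : ∀ c (k : G) (a : Yc c → ℚ), a ∈ Ar c → (fun y => a (k • y)) ∈ Ar c)
    (hRirr : ∀ c (W : Submodule ℚ (Yc c → ℚ)), W ≤ Ar c → W ≠ ⊥ →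
      (∀ (k : G) (f : Yc c → ℚ), f ∈ W → (fun y => f (k • y)) ∈ W) → W = Ar c)
    (hsep : ∀ c c' (L : (Yc c → ℚ) →ₗ[ℚ] (Yc c' → ℚ)), c ≠ c' → Ar c ≠ ⊥ → (∀ a ∈ Ar c, L a ∈ Ar c') →
      (∀ a ∈ Ar c, L a = 0 → a = 0) →
      (∀ (k : G) (a : Yc c → ℚ), a ∈ Ar c → L (fun y => a (k • y)) = fun y => L a (k • y)) → False)
    (ι : ∀ c, JJ c → ((Yc c → ℚ) →ₗ[ℚ] (Y₀ → ℚ)))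
    (hιeq : ∀ c (j : JJ c) (k : G) (a : Yc c → ℚ), a ∈ Ar c →
      ι c j (fun y => a (k • y)) = fun y => ι c j a (k • y))
    (hinj : ∀ (j : JJ c₀) (a : Yc c₀ → ℚ), a ∈ Ar c₀ → ι c₀ j a = 0 → a = 0)
    (hindep : iSupIndep fun q : (Σ c, JJ c) => (Ar q.1).map (ι q.1 q.2))
    (htop : (⨆ c, ⨆ j, (Ar c).map (ι c j)) = ⊤)
    {a₀ : Yc c₀ → ℚ} (ha₀ : a₀ ∈ Ar c₀) (h0 : a₀ ≠ 0)
    {x₀ : Y₀} (htr : ∀ x : Y₀, ∃ g : G, g • x₀ = x) :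
    Fintype.card (JJ c₀) * Module.finrank ℚ ↥(𝒟.map (LinearMap.applyₗ a₀)) ≤ Module.finrank ℚ (Ar c₀) := by
  obtain ⟨F, hF⟩ := exists_fixedSubmodule (G := G) (Y := Yc c₀) x₀
  rw [card_mul_finrank_map_applyₗ_eq_finrank_inf h𝒟 hRst hRirr hsep ι hιeq hinj hindep htop ha₀ h0 htr hF]
  exact Submodule.finrank_mono inf_le_left

/-- **`|J_{c₀}| ≤ dim A_{c₀}/δ_{c₀}`.** [cite: LangeRodriguez2022, §2.8 Lemma 2.8.1 and (2.21)–(2.23)]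
[cite: Serre1977, §12.1] -/
theorem card_le_finrank_div {c₀ : C}
    {𝒟 : Submodule ℚ ((Yc c₀ → ℚ) →ₗ[ℚ] (Yc c₀ → ℚ))}
    (h𝒟 : ∀ L : (Yc c₀ → ℚ) →ₗ[ℚ] (Yc c₀ → ℚ), L ∈ 𝒟 ↔ (∀ a ∈ Ar c₀, L a ∈ Ar c₀) ∧
      ∀ (k : G) (a : Yc c₀ → ℚ), a ∈ Ar c₀ → L (fun y => a (k • y)) = fun y => L a (k • y))
    (hRst : ∀ c (k : G) (a : Yc c → ℚ), a ∈ Ar c → (fun y => a (k • y)) ∈ Ar c)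
    (hRirr : ∀ c (W : Submodule ℚ (Yc c → ℚ)), W ≤ Ar c → W ≠ ⊥ →
      (∀ (k : G) (f : Yc c → ℚ), f ∈ W → (fun y => f (k • y)) ∈ W) → W = Ar c)
    (hsep : ∀ c c' (L : (Yc c → ℚ) →ₗ[ℚ] (Yc c' → ℚ)), c ≠ c' → Ar c ≠ ⊥ → (∀ a ∈ Ar c, L a ∈ Ar c') →
      (∀ a ∈ Ar c, L a = 0 → a = 0) →
      (∀ (k : G) (a : Yc c → ℚ), a ∈ Ar c → L (fun y => a (k • y)) = fun y => L a (k • y)) → False)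
    (ι : ∀ c, JJ c → ((Yc c → ℚ) →ₗ[ℚ] (Y₀ → ℚ)))
    (hιeq : ∀ c (j : JJ c) (k : G) (a : Yc c → ℚ), a ∈ Ar c →
      ι c j (fun y => a (k • y)) = fun y => ι c j a (k • y))
    (hinj : ∀ (j : JJ c₀) (a : Yc c₀ → ℚ), a ∈ Ar c₀ → ι c₀ j a = 0 → a = 0)
    (hindep : iSupIndep fun q : (Σ c, JJ c) => (Ar q.1).map (ι q.1 q.2))
    (htop : (⨆ c, ⨆ j, (Ar c).map (ι c j)) = ⊤)
    {a₀ : Yc c₀ → ℚ} (ha₀ : a₀ ∈ Ar c₀) (h0 : a₀ ≠ 0)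
    {x₀ : Y₀} (htr : ∀ x : Y₀, ∃ g : G, g • x₀ = x) :
    Fintype.card (JJ c₀) ≤ Module.finrank ℚ (Ar c₀) / Module.finrank ℚ ↥(𝒟.map (LinearMap.applyₗ a₀)) :=
  (Nat.le_div_iff_mul_le (finrank_map_applyₗ_pos h𝒟 h0)).2
    (card_mul_finrank_map_applyₗ_le_finrank h𝒟 hRst hRirr hsep ι hιeq hinj hindep htop ha₀ h0 htr)

end OneSlot

/-! ### §2 Two slots of a family: a smaller stabiliser gives larger multiplicities -/

section TwoSlots

variable {I : Type u} {E : I → Type v} [∀ i, MulAction G (E i)] [∀ i, Fintype (E i)]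
  {C : Type uC} [Fintype C] {Yc : C → Type vC} [∀ c, MulAction G (Yc c)] [∀ c, Fintype (Yc c)]
  {Ar : ∀ c, Submodule ℚ (Yc c → ℚ)} {𝒟 : ∀ c, Submodule ℚ ((Yc c → ℚ) →ₗ[ℚ] (Yc c → ℚ))}
  {JJ : I → C → Type uJ} [∀ i c, Fintype (JJ i c)]

/-- **A SMALLER STABILISER GIVES LARGER MULTIPLICITIES: `Stab(x₁) ≤ Stab(x₂) ⟹ |J_{i₂,c}| ≤ |J_{i₁,c}|`.**  Two
transitive slots `E_{i₁} ∋ x₁`, `E_{i₂} ∋ x₂` of a family decomposed over the same references (M-series data, in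
each of the two slots the images independent and spanning); if every `k` fixing `x₁` fixes `x₂` (e.g. a `G`-map
`E_{i₁} → E_{i₂}` with `x₁ ↦ x₂`), then for every class `|J_{i₂,c}|·δ_c = dim A_c^{Stab(x₂)} ≤ dim A_c^{Stab(x₁)} =
|J_{i₁,c}|·δ_c`. [cite: LangeRodriguez2022, §2.8 Lemma 2.8.1] [cite: Serre1977, §7.2 Thm. 13] -/
theorem card_le_card_of_stabilizer_le
    (h𝒟 : ∀ c (L : (Yc c → ℚ) →ₗ[ℚ] (Yc c → ℚ)), L ∈ 𝒟 c ↔ (∀ a ∈ Ar c, L a ∈ Ar c) ∧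
      ∀ (k : G) (a : Yc c → ℚ), a ∈ Ar c → L (fun y => a (k • y)) = fun y => L a (k • y))
    (hRst : ∀ c (k : G) (a : Yc c → ℚ), a ∈ Ar c → (fun y => a (k • y)) ∈ Ar c)
    (hRirr : ∀ c (W : Submodule ℚ (Yc c → ℚ)), W ≤ Ar c → W ≠ ⊥ →
      (∀ (k : G) (f : Yc c → ℚ), f ∈ W → (fun y => f (k • y)) ∈ W) → W = Ar c)
    (hsep : ∀ c c' (L : (Yc c → ℚ) →ₗ[ℚ] (Yc c' → ℚ)), c ≠ c' → Ar c ≠ ⊥ → (∀ a ∈ Ar c, L a ∈ Ar c') →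
      (∀ a ∈ Ar c, L a = 0 → a = 0) →
      (∀ (k : G) (a : Yc c → ℚ), a ∈ Ar c → L (fun y => a (k • y)) = fun y => L a (k • y)) → False)
    (ι : ∀ i c, JJ i c → ((Yc c → ℚ) →ₗ[ℚ] (E i → ℚ)))
    (hιeq : ∀ i c (j : JJ i c) (k : G) (a : Yc c → ℚ), a ∈ Ar c →
      ι i c j (fun y => a (k • y)) = fun y => ι i c j a (k • y))
    (hinj : ∀ i c (j : JJ i c) (a : Yc c → ℚ), a ∈ Ar c → ι i c j a = 0 → a = 0)
    {a₀ : ∀ c, Yc c → ℚ} (ha₀ : ∀ c, a₀ c ∈ Ar c) (h0 : ∀ c, a₀ c ≠ 0)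
    {i₁ i₂ : I}
    (hindep₁ : iSupIndep fun q : (Σ c, JJ i₁ c) => (Ar q.1).map (ι i₁ q.1 q.2))
    (htop₁ : (⨆ c, ⨆ j, (Ar c).map (ι i₁ c j)) = ⊤)
    (hindep₂ : iSupIndep fun q : (Σ c, JJ i₂ c) => (Ar q.1).map (ι i₂ q.1 q.2))
    (htop₂ : (⨆ c, ⨆ j, (Ar c).map (ι i₂ c j)) = ⊤)
    {x₁ : E i₁} (htr₁ : ∀ x : E i₁, ∃ g : G, g • x₁ = x)
    {x₂ : E i₂} (htr₂ : ∀ x : E i₂, ∃ g : G, g • x₂ = x)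
    (hle : ∀ k : G, k • x₁ = x₁ → k • x₂ = x₂) (c : C) :
    Fintype.card (JJ i₂ c) ≤ Fintype.card (JJ i₁ c) := by
  obtain ⟨F₁, hF₁⟩ := exists_fixedSubmodule (G := G) (Y := Yc c) x₁
  obtain ⟨F₂, hF₂⟩ := exists_fixedSubmodule (G := G) (Y := Yc c) x₂
  have h1 := card_mul_finrank_map_applyₗ_eq_finrank_inf (h𝒟 c) hRst hRirr hsep (ι i₁) (hιeq i₁) (hinj i₁ c)
    hindep₁ htop₁ (ha₀ c) (h0 c) htr₁ hF₁
  have h2 := card_mul_finrank_map_applyₗ_eq_finrank_inf (h𝒟 c) hRst hRirr hsep (ι i₂) (hιeq i₂) (hinj i₂ c)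
    hindep₂ htop₂ (ha₀ c) (h0 c) htr₂ hF₂
  -- `F₂ ≤ F₁`: a vector fixed by `Stab(x₂)` is fixed by the smaller `Stab(x₁)`
  have hF : Ar c ⊓ F₂ ≤ Ar c ⊓ F₁ := fun f hf =>
    Submodule.mem_inf.2 ⟨(Submodule.mem_inf.1 hf).1,
      (hF₁ f).2 fun k hk => (hF₂ f).1 (Submodule.mem_inf.1 hf).2 k (hle k hk)⟩
  have hmono := Submodule.finrank_mono hF
  rw [← h1, ← h2] at hmono
  exact Nat.le_of_mul_le_mul_right hmono (finrank_map_applyₗ_pos (h𝒟 c) (h0 c))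

/-- **EQUAL STABILISERS GIVE EQUAL MULTIPLICITIES: `Stab(x₁) = Stab(x₂) ⟹ |J_{i₁,c}| = |J_{i₂,c}|`** (isomorphic
transitive slots have isomorphic permutation modules). [cite: LangeRodriguez2022, §2.8 Lemma 2.8.1]
[cite: Serre1977, §7.2 Thm. 13] -/
theorem card_eq_card_of_stabilizer_eq
    (h𝒟 : ∀ c (L : (Yc c → ℚ) →ₗ[ℚ] (Yc c → ℚ)), L ∈ 𝒟 c ↔ (∀ a ∈ Ar c, L a ∈ Ar c) ∧
      ∀ (k : G) (a : Yc c → ℚ), a ∈ Ar c → L (fun y => a (k • y)) = fun y => L a (k • y))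
    (hRst : ∀ c (k : G) (a : Yc c → ℚ), a ∈ Ar c → (fun y => a (k • y)) ∈ Ar c)
    (hRirr : ∀ c (W : Submodule ℚ (Yc c → ℚ)), W ≤ Ar c → W ≠ ⊥ →
      (∀ (k : G) (f : Yc c → ℚ), f ∈ W → (fun y => f (k • y)) ∈ W) → W = Ar c)
    (hsep : ∀ c c' (L : (Yc c → ℚ) →ₗ[ℚ] (Yc c' → ℚ)), c ≠ c' → Ar c ≠ ⊥ → (∀ a ∈ Ar c, L a ∈ Ar c') →
      (∀ a ∈ Ar c, L a = 0 → a = 0) →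
      (∀ (k : G) (a : Yc c → ℚ), a ∈ Ar c → L (fun y => a (k • y)) = fun y => L a (k • y)) → False)
    (ι : ∀ i c, JJ i c → ((Yc c → ℚ) →ₗ[ℚ] (E i → ℚ)))
    (hιeq : ∀ i c (j : JJ i c) (k : G) (a : Yc c → ℚ), a ∈ Ar c →
      ι i c j (fun y => a (k • y)) = fun y => ι i c j a (k • y))
    (hinj : ∀ i c (j : JJ i c) (a : Yc c → ℚ), a ∈ Ar c → ι i c j a = 0 → a = 0)
    {a₀ : ∀ c, Yc c → ℚ} (ha₀ : ∀ c, a₀ c ∈ Ar c) (h0 : ∀ c, a₀ c ≠ 0)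
    {i₁ i₂ : I}
    (hindep₁ : iSupIndep fun q : (Σ c, JJ i₁ c) => (Ar q.1).map (ι i₁ q.1 q.2))
    (htop₁ : (⨆ c, ⨆ j, (Ar c).map (ι i₁ c j)) = ⊤)
    (hindep₂ : iSupIndep fun q : (Σ c, JJ i₂ c) => (Ar q.1).map (ι i₂ q.1 q.2))
    (htop₂ : (⨆ c, ⨆ j, (Ar c).map (ι i₂ c j)) = ⊤)
    {x₁ : E i₁} (htr₁ : ∀ x : E i₁, ∃ g : G, g • x₁ = x)
    {x₂ : E i₂} (htr₂ : ∀ x : E i₂, ∃ g : G, g • x₂ = x)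
    (heq : ∀ k : G, k • x₁ = x₁ ↔ k • x₂ = x₂) (c : C) :
    Fintype.card (JJ i₁ c) = Fintype.card (JJ i₂ c) :=
  le_antisymm
    (card_le_card_of_stabilizer_le h𝒟 hRst hRirr hsep ι hιeq hinj ha₀ h0 hindep₂ htop₂ hindep₁ htop₁ htr₂ htr₁
      (fun k hk => (heq k).2 hk) c)
    (card_le_card_of_stabilizer_le h𝒟 hRst hRirr hsep ι hιeq hinj ha₀ h0 hindep₁ htop₁ hindep₂ htop₂ htr₁ htr₂
      (fun k hk => (heq k).1 hk) c)

end TwoSlots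

/-! ### §3 With no input but the slots -/

section NoInput

variable {I : Type u} {E : I → Type v} [∀ i, MulAction G (E i)] [∀ i, Fintype (E i)] [Fintype I]

/-- **THE MULTIPLICITY BOUNDS WITH NO INPUT BUT THE SLOTS.**  For finite `G`-sets `E_i` there is an isotypic
decomposition `ℚ^{E_i} ≅ ⊕_c A_c^{m_{i,c}}` (gen 76 E3, with commutants and non-zero `a₀_c`) such that:
for every transitive slot `E_i ∋ x₀`, **`m_{i,c}·δ_c ≤ dim A_c`**; and for two transitive slots `E_{i₁} ∋ x₁`,
`E_{i₂} ∋ x₂` with `Stab(x₁) ≤ Stab(x₂)`, **`m_{i₂,c} ≤ m_{i₁,c}`** for every class.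
[cite: LangeRodriguez2022, §2.8 Lemma 2.8.1] [cite: Serre1977, §7.2 Thm. 13 and §12.1] -/
theorem exists_isotypic_card_le :
    ∃ (n : ℕ) (Ar : Fin n → Submodule ℚ ((Σ i, E i) → ℚ))
      (𝒟 : Fin n → Submodule ℚ (((Σ i, E i) → ℚ) →ₗ[ℚ] ((Σ i, E i) → ℚ))) (m : I → Fin n → ℕ)
      (ι : ∀ (i : I) (c : Fin n), Fin (m i c) → (((Σ i, E i) → ℚ) →ₗ[ℚ] (E i → ℚ)))
      (a₀ : Fin n → ((Σ i, E i) → ℚ)),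
      (∀ (c : Fin n) (L : ((Σ i, E i) → ℚ) →ₗ[ℚ] ((Σ i, E i) → ℚ)), L ∈ 𝒟 c ↔ (∀ a ∈ Ar c, L a ∈ Ar c) ∧
        ∀ (k : G) (a : (Σ i, E i) → ℚ), a ∈ Ar c → L (fun x => a (k • x)) = fun x => L a (k • x)) ∧
      (∀ (c : Fin n) (k : G) (a : (Σ i, E i) → ℚ), a ∈ Ar c → (fun x => a (k • x)) ∈ Ar c) ∧
      (∀ (c : Fin n) (W : Submodule ℚ ((Σ i, E i) → ℚ)), W ≤ Ar c → W ≠ ⊥ →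
        (∀ (k : G) (f : (Σ i, E i) → ℚ), f ∈ W → (fun x => f (k • x)) ∈ W) → W = Ar c) ∧
      (∀ c : Fin n, Ar c ≠ ⊥) ∧
      (∀ (c c' : Fin n) (L : ((Σ i, E i) → ℚ) →ₗ[ℚ] ((Σ i, E i) → ℚ)), c ≠ c' → Ar c ≠ ⊥ →
        (∀ a ∈ Ar c, L a ∈ Ar c') → (∀ a ∈ Ar c, L a = 0 → a = 0) →
        (∀ (k : G) (a : (Σ i, E i) → ℚ), a ∈ Ar c → L (fun x => a (k • x)) = fun x => L a (k • x)) →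
        False) ∧
      (∀ (i : I) (c : Fin n) (j : Fin (m i c)) (k : G) (a : (Σ i, E i) → ℚ), a ∈ Ar c →
        ι i c j (fun x => a (k • x)) = fun s => ι i c j a (k • s)) ∧
      (∀ (i : I) (c : Fin n) (j : Fin (m i c)) (a : (Σ i, E i) → ℚ), a ∈ Ar c → ι i c j a = 0 → a = 0) ∧
      (∀ i : I, iSupIndep fun q : (Σ c : Fin n, Fin (m i c)) => (Ar q.1).map (ι i q.1 q.2)) ∧
      (∀ i : I, (⨆ c : Fin n, ⨆ j : Fin (m i c), (Ar c).map (ι i c j)) = ⊤) ∧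
      (∀ c, a₀ c ∈ Ar c) ∧ (∀ c, a₀ c ≠ 0) ∧
      (∀ (i : I) (x₀ : E i), (∀ x : E i, ∃ g : G, g • x₀ = x) →
        ∀ c, m i c * Module.finrank ℚ ↥((𝒟 c).map (LinearMap.applyₗ (a₀ c))) ≤ Module.finrank ℚ (Ar c)) ∧
      ∀ (i₁ i₂ : I) (x₁ : E i₁) (x₂ : E i₂), (∀ x : E i₁, ∃ g : G, g • x₁ = x) →
        (∀ x : E i₂, ∃ g : G, g • x₂ = x) → (∀ k : G, k • x₁ = x₁ → k • x₂ = x₂) →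
        ∀ c, m i₂ c ≤ m i₁ c := by
  obtain ⟨n, Ar, m, ι, hRst, hRirr, hR0, hsep, hιeq, hind, hindep, htop, -⟩ :=
    exists_isotypic_decomposition (G := G) (E := E)
  obtain ⟨𝒟, h𝒟⟩ := exists_commutants (G := G) Ar
  obtain ⟨a₀, ha₀, h0⟩ := exists_mem_ne_zero_of_forall_ne_bot hR0
  have hinj : ∀ (i : I) (c : Fin n) (j : Fin (m i c)) (a : (Σ i, E i) → ℚ), a ∈ Ar c → ι i c j a = 0 → a = 0 :=
    fun i c j a ha hz => injOn_of_jointly_independent (ι i c) (hind i c) j a ha hz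
  refine ⟨n, Ar, 𝒟, m, ι, a₀, h𝒟, hRst, hRirr, hR0, hsep, hιeq, hinj, hindep, htop, ha₀, h0,
    fun i x₀ htr c => ?_, fun i₁ i₂ x₁ x₂ htr₁ htr₂ hle c => ?_⟩
  · have h1 := card_mul_finrank_map_applyₗ_le_finrank (Yc := fun _ : Fin n => Σ i, E i)
      (JJ := fun c => Fin (m i c)) (h𝒟 c) hRst hRirr hsep (ι i) (hιeq i) (hinj i c) (hindep i) (htop i) (ha₀ c)
      (h0 c) htr
    simpa only [Fintype.card_fin] using h1
  · have h1 := card_le_card_of_stabilizer_le (Yc := fun _ : Fin n => Σ i, E i) (JJ := fun i c => Fin (m i c))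
      h𝒟 hRst hRirr hsep ι hιeq hinj ha₀ h0 (hindep i₁) (htop i₁) (hindep i₂) (htop i₂) htr₁ htr₂ hle c
    simpa only [Fintype.card_fin] using h1

end NoInput

end Summit.HodgeConjecture.CorCM.IrrOdd

/-! ### §4 Number fields: a subfield's permutation module has smaller multiplicities -/

namespace Summit.HodgeConjecture.CorCM

open NumberField
open Literature.NumberTheory.ComplexMultiplication
open Literature.AlgebraicGeometry.Pohlmann1968

variable {I : Type} [Fintype I] {K : I → Type} [∀ i, Field (K i)] [∀ i, NumberField (K i)]

omit [Fintype I] [∀ i, NumberField (K i)] in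
/-- A ring map `e : K₂ → K₁` makes the stabiliser of `x₁ : K₁ → ℂ` fix `x₁ ∘ e`. [folklore] -/
theorem smul_comp_eq_of_smul_eq {i₁ i₂ : I} (e : K i₂ →+* K i₁) (x₁ : K i₁ →+* ℂ) (k : ℂ ≃+* ℂ)
    (hk : k • x₁ = x₁) : k • x₁.comp e = x₁.comp e := by
  rw [smul_embedding_eq_self_iff] at hk ⊢
  exact fun a => hk (e a)

/-- **A SUBFIELD'S PERMUTATION MODULE HAS SMALLER MULTIPLICITIES, CLASS BY CLASS.**  For number fields `K_i` there is
an `Aut(ℂ)`-isotypic decomposition `ℚ^{Hom(K_i, ℂ)} ≅ ⊕_c A_c^{m_{i,c}}` over pairwise non-embeddable irreducibles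
`A_c ≤ ℚ^{⊔_i Hom(K_i, ℂ)}` (commutants `𝒟_c`, non-zero `a₀_c`, `δ_c = dim 𝒟_c·a₀_c`) such that
**`m_{i,c}·δ_c ≤ dim A_c`** for all `i, c`, and **for every ring map `e : K_{i₂} → K_{i₁}` and every class,
`m_{i₂,c} ≤ m_{i₁,c}`** (`Stab(x₁) ≤ Stab(x₁ ∘ e)`; the slots are single orbits).
[cite: LangeRodriguez2022, §2.8 Lemma 2.8.1] [cite: Gordon1999HodgeAVSurvey, §9.2 (proof)] -/
theorem exists_isotypic_card_le_card_of_ringHom :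
    ∃ (n : ℕ) (Ar : Fin n → Submodule ℚ ((Σ i, (K i →+* ℂ)) → ℚ))
      (𝒟 : Fin n → Submodule ℚ (((Σ i, (K i →+* ℂ)) → ℚ) →ₗ[ℚ] ((Σ i, (K i →+* ℂ)) → ℚ)))
      (m : I → Fin n → ℕ)
      (ι : ∀ (i : I) (c : Fin n), Fin (m i c) → (((Σ i, (K i →+* ℂ)) → ℚ) →ₗ[ℚ] ((K i →+* ℂ) → ℚ)))
      (a₀ : Fin n → ((Σ i, (K i →+* ℂ)) → ℚ)),
      (∀ (c : Fin n) (L : ((Σ i, (K i →+* ℂ)) → ℚ) →ₗ[ℚ] ((Σ i, (K i →+* ℂ)) → ℚ)), L ∈ 𝒟 c ↔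
        (∀ a ∈ Ar c, L a ∈ Ar c) ∧ ∀ (k : ℂ ≃+* ℂ) (a : (Σ i, (K i →+* ℂ)) → ℚ), a ∈ Ar c →
          L (fun x => a (k • x)) = fun x => L a (k • x)) ∧
      (∀ (c : Fin n) (k : ℂ ≃+* ℂ) (a : (Σ i, (K i →+* ℂ)) → ℚ), a ∈ Ar c → (fun x => a (k • x)) ∈ Ar c) ∧
      (∀ (c : Fin n) (W : Submodule ℚ ((Σ i, (K i →+* ℂ)) → ℚ)), W ≤ Ar c → W ≠ ⊥ →
        (∀ (k : ℂ ≃+* ℂ) (f : (Σ i, (K i →+* ℂ)) → ℚ), f ∈ W → (fun x => f (k • x)) ∈ W) → W = Ar c) ∧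
      (∀ c : Fin n, Ar c ≠ ⊥) ∧
      (∀ (c c' : Fin n) (L : ((Σ i, (K i →+* ℂ)) → ℚ) →ₗ[ℚ] ((Σ i, (K i →+* ℂ)) → ℚ)), c ≠ c' → Ar c ≠ ⊥ →
        (∀ a ∈ Ar c, L a ∈ Ar c') → (∀ a ∈ Ar c, L a = 0 → a = 0) →
        (∀ (k : ℂ ≃+* ℂ) (a : (Σ i, (K i →+* ℂ)) → ℚ), a ∈ Ar c →
          L (fun x => a (k • x)) = fun x => L a (k • x)) → False) ∧
      (∀ (i : I) (c : Fin n) (j : Fin (m i c)) (k : ℂ ≃+* ℂ) (a : (Σ i, (K i →+* ℂ)) → ℚ), a ∈ Ar c →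
        ι i c j (fun x => a (k • x)) = fun s => ι i c j a (k • s)) ∧
      (∀ (i : I) (c : Fin n) (j : Fin (m i c)) (a : (Σ i, (K i →+* ℂ)) → ℚ), a ∈ Ar c →
        ι i c j a = 0 → a = 0) ∧
      (∀ i : I, iSupIndep fun q : (Σ c : Fin n, Fin (m i c)) => (Ar q.1).map (ι i q.1 q.2)) ∧
      (∀ i : I, (⨆ c : Fin n, ⨆ j : Fin (m i c), (Ar c).map (ι i c j)) = ⊤) ∧
      (∀ c, a₀ c ∈ Ar c) ∧ (∀ c, a₀ c ≠ 0) ∧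
      (∀ i c, m i c * Module.finrank ℚ ↥((𝒟 c).map (LinearMap.applyₗ (a₀ c))) ≤ Module.finrank ℚ (Ar c)) ∧
      ∀ (i₁ i₂ : I) (_e : K i₂ →+* K i₁) (c : Fin n), m i₂ c ≤ m i₁ c := by
  haveI : ∀ i, Nonempty (K i →+* ℂ) := fun i => inferInstance
  obtain ⟨n, Ar, 𝒟, m, ι, a₀, h𝒟, hRst, hRirr, hR0, hsep, hιeq, hinj, hindep, htop, ha₀, h0, hbd, hmono⟩ :=
    IrrOdd.exists_isotypic_card_le (G := ℂ ≃+* ℂ) (E := fun i => K i →+* ℂ)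
  refine ⟨n, Ar, 𝒟, m, ι, a₀, h𝒟, hRst, hRirr, hR0, hsep, hιeq, hinj, hindep, htop, ha₀, h0, fun i c => ?_,
    fun i₁ i₂ e c => ?_⟩
  · obtain ⟨x₀⟩ := (inferInstance : Nonempty (K i →+* ℂ))
    exact hbd i x₀ (exists_smul_embedding_eq x₀) c
  · obtain ⟨x₁⟩ := (inferInstance : Nonempty (K i₁ →+* ℂ))
    exact hmono i₁ i₂ x₁ (x₁.comp e) (exists_smul_embedding_eq x₁) (exists_smul_embedding_eq (x₁.comp e))
      (fun k hk => smul_comp_eq_of_smul_eq e x₁ k hk) c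

end Summit.HodgeConjecture.CorCM

end
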